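import Mathlib
import HarnessLib
import HarnessLib.Audit
import Summits.BirchSwinnertonDyer.Statement
import Summits.BirchSwinnertonDyer.BirchSwinnertonDyer.Theorems.HigherGrossZagierDefs
import Summits.BirchSwinnertonDyer.BirchSwinnertonDyer.Theorems.HigherGrossZagierGram
import Literature.NumberTheory.EllipticCurves.Heights
import Literature.NumberTheory.EllipticCurves.HeightsProofs
import Literature.NumberTheory.EllipticCurves.MordellWeilTheoremProofs
import HarnessLib.Audit.Status.Attr

/-!
Route: HigherGrossZagier

CLOSED (superseded) 2026-08-30T01:20:29Z by planner-rlead-bsd-HigherGrossZagier-g2-0 — reason: superseded:route-BirchSwinnertonDyer-Squeeze — superseded by route-BirchSwinnertonDyer-Squeeze — note: D-0179 (director-bsd ruling (457)(A), 2026-08-30T00:55:42Z; route kill criterion «supersede by Squeeze if #2 stays mechanism-free» MET): BLOCKER = stmt-0501 HigherGZConstructionR2 COSTUME/skew (kernel certificate construction_iff : 0501 ↔ HigherGZLowerBoundR2 ∧ SIGN2, SIGN2 beyond the rank-only summ. The file is kept as the record of this route; refuted decls are indexed as negative knowledge (`ledger negatives`).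

POSITED OBJECT (interface `Literature.EllArith.HigherGrossZagierDatum W r`,
Theorems/HigherGrossZagierDefs.lean): a rank-r Gross–Zagier datum for E/ℚ is (P_1,…,P_r ∈ E(ℚ), c ∈
ℝ_{>0}) with L^{(r)}(E,1)/r! = c · det(⟨P_i,P_j⟩)_{i,j} (Néron–Tate height pairing, Clay
normalisation). It suffices to show X := (CONSTRUCTION) every E/ℚ admits a rank-r datum with r =
r_an(E) ∧ (UB) r_MW ≤ r_an for every E/ℚ (target HigherGZThesisR2 = X). Ranked parts:
HigherGZConstructionR2 (r_an ≥ 2: the open heart), SqueezeUBR2 (no excess rank; shared with route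
Squeeze); literature leaf HigherGZRankOneR2 (r_an = 1: rank-one Gross–Zagier over ℚ, GrossZagier1986
Thm I.6.3 + §V.2 with a non-vanishing twist; body verbatim the Literature fact
WeierstrassCurve.gross_zagier_rank_one_rat); TARGET FRAME (route-choice 2026-08-16): literature leaf
HigherGZRankZeroR2 (r_an = 0: leadingLCoeff = L(E,1) ∈ ℝ_{>0}; BCDTJAMS2001 Thm A + Guo1996 /
LapidRallis2003 Thm 1 + reality of the Taylor coefficients) and the glue HigherGZTargetGlueR2 :
HigherGZRankZeroR2 → HigherGZRankOneR2 → HigherGZConstructionR2 → SqueezeUBR2 → HigherGZThesisR2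
(provable now; planner proof sorry-free, attached), so X is reachable from the items. Deciding
theorem (PROVED, certified native, modularity-free): closes : HigherGZConstructionR2 → SqueezeUBR2 →
HigherGZRankOneR2 → BirchSwinnertonDyer (= assembly item Assembly3; no route decl names a cite-only
constant since rev 7; the incident-era legacy frames Assembly/Assembly2 and the r1 duplicate support
decls are true but redundant, pending operator removal — see rationale).
Lean: `(∀ (W : WeierstrassCurve ℚ) [W.IsElliptic], ∃ (P : Fin W.analyticRank → W.toAffine.Point) (c
: ℝ), 0 < c ∧ W.leadingLCoeff = ((c * (Matrix.of fun i j => (P i).heightPairing (P j)).det : ℝ) :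
ℂ)) ∧ (∀ (W : WeierstrassCurve ℚ) [W.IsElliptic], W.mordellWeilRank ≤ W.analyticRank)`

Rationale: WHY THIS LINE. In rank 1 the datum EXISTS and is the whole story: GrossZagier1986 Thm I.6.3 + §V.2
with a non-vanishing quadratic twist (BumpFriedbergHoffstein1990 / MurtyMurty1991) give L'(E,1) =
c·ĥ(P) with c > 0 — the tree's named fact WeierstrassCurve.gross_zagier_rank_one_rat
(GrossZagierRankOne.lean:46), consumed here as the route item HigherGZRankOneR2; its datum form
(HigherGZRankOneDatumR5) and the Gram lemma (HigherGZGramLemmaR2) have sorry-free proofs in tree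
(Literature.EllArith.higherGZ_rankOneDatum; Literature.EllArith.gram_lemma). Every programme aiming
beyond rank 1 — YuanZhangZhang2013 (Shimura curves), GrossKohnenZagier1987 (heights of Heegner
divisors as coefficients), DarmonRotger2016 = doi:10.1186/s40687-016-0074-9 (diagonal cycles, rank-2
phenomena at Selmer level), Kudla's arithmetic theta series, YunZhang2017 = arXiv:1512.02683 (r-th
central derivative = self-intersection on Sht^r, function fields), plectic points ForneaGehrmann2023
= arXiv:2104.12575 — tries to produce special cycles whose height REGULATOR (a determinant, not one
height) is an L-derivative; the route states that target over ℚ as an interface whose r = 1 instance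
and assembly are proved in tree. Imported area: arithmetic intersection theory / automorphic periods
(PROBLEMS.md §3 line 2). GLUE (certified native, axioms propext / Classical.choice / Quot.sound):
closes : HigherGZConstructionR2 → SqueezeUBR2 → HigherGZRankOneR2 → BirchSwinnertonDyer is proved
WITHOUT modularity — if r_an(W) ≠ 0 then W.entireLFunction is analytic at 1 of finite order r_an
(junk-robust reading of analyticOrderNatAt), so leadingLCoeff W ≠ 0 by pure Mathlib; det ≠ 0 ⇒ r ≤
rank is Literature.EllArith.gram_lemma fed with the discharged facts module_finite_point_holds
(Mordell–Weil, MordellWeilTheoremProofs.lean) and heightPairing_add_left_holds /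
heightPairing_self_holds (HeightsProofs.lean); UB gives equality. TARGET FRAME (route-choice
2026-08-16, operator hold route.target-unreachable, option (a)): X itself is now reachable from the
items by the support glue HigherGZTargetGlueR2 : HigherGZRankZeroR2 → HigherGZRankOneR2 →
HigherGZConstructionR2 → SqueezeUBR2 → HigherGZThesisR2 (pure logic + heightPairing_self_holds;
planner Sketch.lean targetGlue_holds sorry-free, std axioms, attached as evidence on stmt-14219)
with ONE new literature leaf HigherGZRankZeroR2 (stmt-14178: r_an = 0 → leadingLCoeff = L(E,1) ∈
ℝ_{>0} — the r = 0 datum, empty family, det = 1; KNOWN modulo hasEntireLFunction_rat +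
re_entireLFunction_one_nonneg (Guo1996 / LapidRallis2003 Thm 1, BSDQuadraticDescent.lean:310) +
leadingLCoeff_im_eq_zero, derivation rankZero_of_facts sorry-free in the same sketch); this is
exactly the r_an = 0 sign content by which X exceeds BSD-rank (refuter Collapse.lean: X ↔ BSD ∧ ∀ E,
leadingLCoeff ∈ ℝ_{>0}); closes is unchanged and still bypasses X. CONE (rev 7, 2026-08-15;
unchanged by the two new decls, which name only analyticRank / leadingLCoeff / route decls): no
route decl names a cite-only constant — `route show`: staffable, 0 unproved deps among 30 project
constants. The rank-one Gross–Zagier CONTENT enters only as the item HigherGZRankOneR2 (its body is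
verbatim the Literature fact WeierstrassCurve.gross_zagier_rank_one_rat; closing it = formalising
GrossZagier1986 I.6.3 + V.2 over ℚ, XL), HigherGZRankOneDatumR5 takes HigherGZRankOneR2 as its
antecedent, and the legacy frames Assembly / Assembly2 spell out their `W.HasEntireLFunction`
hypotheses instead of naming hasEntireLFunction_rat / leadingLCoeff_ne_zero (delta-equal rewrites,
certified by rfl; both stay true = Literature.EllArith.higherGZ_assembly). needs-fact:
WeierstrassCurve.hasEntireLFunction_rat — statement-level only:
Summits/BirchSwinnertonDyer/BirchSwinnertonDyer/Statement.lean imports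
Literature.NumberTheory.EllipticCurves.AnalyticRank (analyticRank := analyticOrderNatAt of the
chosen entire continuation, junk 0 without it), so the fact (modularity ⇒ entire continuation,
Wiles1995 / BCDTJAMS2001 Thm A) sits in the MODULE cone of every BSD route and is used by every
eventual PROOF of the cruxes, never as a hypothesis of this route's cruxes or glue; tier-0
Literature debt under active work (reduced in tree to exists_isNewformOf by
hasEntireLFunction_rat_of_exists_isNewformOf; BCDT Thm B + CDT 7.2.4 chain in AnalyticRankBCDTProofs
/ AnalyticRankBCDTTheoremBProofs). SHAPE DEBT (operator): three assembly-kind items — Assembly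
(stmt-0259), Assembly2 (stmt-0500) and Assembly3 (stmt-1034 = the type of closes) — and five r1
duplicate support decls (HigherGZThesis 0258 / HigherGZConstruction 0147 / HigherGZRankOne 0148 /
HigherGZGramLemma 0149 / SqueezeUB 0145, byte-identical to the R2 items) survive from the 2026-08-13
false-closure incident; planner verbs can neither drop nor re-badge assembly-kind items (probed by
repair seats g2–g4: --drop refused, --retriage refuses the kind, every restate is bounced by the
multi-assembly projection), so the one-command cleanup `ledger route edit
route-BirchSwinnertonDyer-HigherGrossZagier --drop Assembly --drop Assembly2 --drop HigherGZThesis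
--drop HigherGZConstruction --drop HigherGZRankOne --drop HigherGZGramLemma --drop SqueezeUB`
(leaving Assembly3 as the single assembly; target state self-checked rc 0) is an operator action.
RANKED CRUXES. #2 HigherGZConstructionR2 — for r_an ≥ 2 produce r_an rational points and c > 0 with
leadingLCoeff = c·det⟨P_i,P_j⟩ (the open heart; it forces r_an ≤ r_MW and positivity of the leading
Taylor coefficient, the latter known only under GRH; why it might fail: no construction of even ONE
non-torsion point is known once L(E,1) = L'(E,1) = 0 — Heegner points are torsion there; sources
YunZhang2017 p.3 + App. A, ForneaGehrmann2023 p.3, DarmonRotger2016 p.4,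
Literature.Barriers.BirchSwinnertonDyer.HeegnerPointBarrier). #4 SqueezeUBR2 — r_MW ≤ r_an (no
excess rank; shared with route Squeeze; open for r_an ≥ 2, Kolyvagin1990 / Kato2004 Thm 14.2 + 18.4
give r_an ≤ 1 and the Selmer-level bound only; one excess-rank curve kills it and BSD). Support:
HigherGZRankOneR2 (rank 3; body verbatim the Literature fact gross_zagier_rank_one_rat; the
literature leaf of closes), HigherGZRankZeroR2 (rank 7; r_an = 0 leaf of the target glue, L(E,1) >
0: BCDTJAMS2001 Thm A + Guo1996), HigherGZTargetGlueR2 (rank 8; items → X, provable now),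
HigherGZGramLemmaR2 (rank 5; proved in tree, Literature.EllArith.gram_lemma) and
HigherGZRankOneDatumR5 (rank 6; HigherGZRankOneR2 → heightPairing_self → the r_an = 1 datum; proved
in tree, Literature.EllArith.higherGZ_rankOneDatum); target HigherGZThesisR2 (rank 0) = X; THE
assembly is Assembly3 (rank 1) = HigherGZConstructionR2 → SqueezeUBR2 → HigherGZRankOneR2 →
BirchSwinnertonDyer, the type of closes (its proof IS closes); redundant and pending operator
removal: the legacy frames Assembly / Assembly2 (true) and the r1 duplicate support decls
HigherGZThesis / HigherGZConstruction / HigherGZRankOne / HigherGZGramLemma / SqueezeUB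
(byte-identical to the R2 items).
KILL CRITERIA. One curve with r_MW > r_an refutes SqueezeUBR2 and BSD itself (close
refuted:SqueezeUBR2). With c free no single curve refutes the datum; the informative kill of #2 is
structural — a proof that a rank-r_an datum forces a SPECIFIC c incompatible with the BSD
leading-term prediction c = Ω_E·∏c_p·#Ш/(#tors²·index²) on a computed curve — or a certified curve
with L^{(r_an)}(E,1)/r_an! < 0 (excluded only under GRH, YunZhang2017 App. A p.74). Standing refuter
advisory (refute-pool-4/7/9 2026-08-13, retriage 2026-08-14): with c free X ⇔ BSD-rank ∧
sign(leading coefficient) > 0, novelty grade VARIANT — the tenure move is to pin c and name a cycle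
construction for #2 (note: c ∈ ℚ_{>0}·Ω_E is dense in ℝ_{>0}, so pinning c up to ℚ^× buys no
numerical refutability; only the full leading-term formula with #Ш does), or supersede by route
Squeeze if #2 stays mechanism-free; proved elsewhere, Squeeze (UB + LB+1 + parity) moots this route.
NOT DECOMPOSED YET. Which cycles realise #2 (the research content: diagonal cycles, arithmetic theta
series, higher CM cycles YuanZhangZhang2013 / Zhang2014, plectic points — none fixed); the
field-descent step (datum over an imaginary quadratic K ⇒ datum over ℚ needs a twist with r_an(E^D)
≤ 1, BumpFriedbergHoffstein1990); p-adic variants (BertoliniDarmon1995 derived heights would give a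
p-adic rank-r datum) belong to route PAdicOrder. Also not filed: the split of #2 into (LB: 2 ≤ r_an
→ r_an ≤ r_MW) and (SIGN: 0 < L^{(r_an)}(E,1)/r_an! as a real number), to which #2 is equivalent
given positive-definiteness of the Néron–Tate pairing — a glued split for tenure once either half
has a mechanism.
CHEAPEST FALSIFIER. LMFDB curves with r_an ∈ {2, 3} (w and L^{(k)}(E,1) = 0 for k < r_an certified,
Bober2013): check L^{(r_an)}(E,1)/r_an! > 0 and r_MW = r_an — every tabulated example complies
(refuter refute-pool-4 note on stmt-BirchSwinnertonDyer-0501: LMFDB leading terms positive, r_an ≤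
3); ranks and leading terms are not computable in tree, so no kit run in this repair.

Novelty: Nearest prior art (searched 2026-08-14: lit search/vsearch/frontier/bridges + barrier catalogue).
(1) SHAPE = Deligne–Beilinson/BSD leading term with the constant freed:
book:burns2007-l-functions-galois-representations (Venjakob) p.393 Conj 3.2, p.394 Conj 3.5 + Ex
3.4B; r=1 = GrossZagier1986 Thm I.6.3+V.2 & Kolyvagin1990 (tree fact gross_zagier_rank_one_rat). (2)
MECHANISM: YunZhang2017 = arXiv:1512.02683 (r-th central derivative = self-intersection on Sht^r,
function fields; p.3: number-field analogues 'only exist ... when r ≤ 1', no conjecture formulated).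
Over ℚ every rank ≥ 2 result is p-adic and Selmer-level: DarmonRotger2016 =
doi:10.1186/s40687-016-0074-9 p.4, DarmonLauderRotger2015, CastellaHsieh2022, Kim2022HigherGZ =
arXiv:2203.12161, BertoliniDarmon1995; the point-level programme is conjectural and plectic:
ForneaGehrmann2023 = arXiv:2104.12575 p.3 ('P ∈ ∧^r A(E) non-torsion exactly when r_alg = r').
DELTA: archimedean Néron–Tate regulator of r rational points vs the r-th derivative of L(E,s)
itself, all r ≥ 2 over ℚ, as an interface whose r=1 instance and assembly are proved in tree
(Literature.EllArith.higherGZ_rankOneDatum, higherGZ_assembly). NO construction mechanism is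
proposed and, c being free, refuters (pool-4/7/9) showed X ⇔ BSD-rank ∧ (leading Taylor coefficient
> 0). Self-grade: VARIANT (BSD-rank repackaged with a sign rider); a genuine higher-GZ thesis needs
c pinned (c ∈ ℚ_{>0}·Ω_E) and a named cycle/plectic construction.  [refs: 10.1186/s40687-016-0074-9, 1512.02683, 2203.12161, 2104.12575, book:burns2007-l-functions-galois-representations, doi:10.1186/s40687-016-0074-9, GrossZagier1986, Kolyvagin1990, YunZhang2017, DarmonRotger2016, DarmonLauderRotger2015, CastellaHsieh2022, BertoliniDarmon1995, ForneaGehrmann2023]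

Barriers (technique_class: gross-zagier heegner-points arithmetic-intersection heights): - Literature.Barriers.BirchSwinnertonDyer.HeegnerPointBarrier : APPLIES squarely to crux
HigherGZConstructionR2 (r_an ≥ 2 ⇒ Heegner points torsion: the proved r=1 datum cannot be iterated).
NOT evaded: no replacement supply of points is named; the bet is a future number-field Sht^r
(YunZhang2017 p.3) or algebraic plectic points (ForneaGehrmann2023); catalogued evasions
(WZhang2014, CastellaHsieh2022, DarmonRotger2016) give Selmer classes, not points.
- Literature.Barriers.BirchSwinnertonDyer.SelmerRankBarrier : APPLIES to both cruxes; classes reach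
E(ℚ) only via corank Ш[p^∞] = 0 (open, r_an ≥ 2): not evaded. For SqueezeUBR2, rank ≤ corank Sel ≤
ord_T L_p (Kato2004 18.4) evades Ш but needs ord_T L_p ≤ ord_{s=1} L, meeting
Literature.Barriers.BirchSwinnertonDyer.PAdicHeightBarrier and
Literature.Barriers.BirchSwinnertonDyer.ExceptionalZeroBarrier (route PAdicOrder).
- Literature.Barriers.BirchSwinnertonDyer.AnticyclotomicHeightDegeneracy : N/A (nor
PAdicHeightBarrier) for the datum: archimedean Néron–Tate regulator, positive definite
(SilvermanAEC2009 VIII.9.6).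
- Literature.Barriers.BirchSwinnertonDyer.NumericalVanishingBarrier : APPLIES to the kill criterion
(certifiable only for r_an ≤ 3, Bober2013); with c free no curve refutes the datum: a kill needs c
pinned.
- Literature.Barriers.BirchSwinnertonDyer.FunctionalEquationSeesOnlyParity : APPLIES to the hidden
sign conjunct (L^(r)(E,1)/r! > 0, r ≥ 2), invisible to root numbers; known under GRH only
(YunZhang2017 App. A).

Novelty grade: variant — VARIANT (refuter route review 2026-08-15; confirms the header's self-grade and pool-4/7/9). Nearest prior art: the BSD / Deligne–Beilinson leading-term SHAPE with the transcendental constant freed (Venjakob in Burns et al. 2007, Conj 3.5 + Ex 3.4B) and its proved r = 1 instance (GZ86 I.6.3 + V.2 + K (refuter refuter-rreview1-BirchSwinnertonDyer-HigherGros-9abfdd8a-0, 2026-08-15T18:29:26Z; prior: GrossZagier1986 Thm I.6.3 + V.2 (r=1 datum; tree fact gross_zagier_rank_one_rat), Kolyvagin1990 Thm A, book:burns2007-l-functions-galois-representations (Venjakob) p.393 Conj 3.2, p.394 Conj 3.5 + Ex 3.4B (BSD/Deligne-Beilinson leading-term shape with the constant freed), YunZhang2017 = arXiv:1512.02683 p.3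 + App. A p.74 (Sht^r, function fields; sign under GRH), arXiv:2607.07531 (2026, higher GZ f)

History (route lifecycle, newest last):
- 2026-08-16T14:43:05Z · LINT AUTOFIX route.multi-assembly: kept Assembly3, dropped Assembly, Assembly2 (gate:hygiene)
- 2026-08-26T15:42:42Z · DORMANT — reconciler: no traction for 6.2 d (last activity item-evidence-added at 2026-08-20T10:52:23Z); parked, not closed — `ledger route dormant route-BirchSwinnertonD (operator:999:2772342)
- 2026-08-29T01:44:08Z · REACTIVATED — reconciler: reactivated — activity item-evidence-added at 2026-08-29T00:35:58Z after parking at 2026-08-26T15:42:42Z (operator:999:1182686)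
- 2026-08-30T01:20:30Z · CLOSED superseded — superseded:route-BirchSwinnertonDyer-Squeeze (planner-rlead-bsd-HigherGrossZagier-g2-0)

sub-problem: BirchSwinnertonDyer · status: closed(superseded) · opened planner-BirchSwinnertonDyer-Survey-0 2026-08-13T06:05:31Z · rev 14 · ledger route-BirchSwinnertonDyer-HigherGrossZagier
GENERATED by the gate from the ledger (D-0016/17). Provers cite these decls: `theorem foo : Summit.BirchSwinnertonDyer.BirchSwinnertonDyer.Theses.HigherGrossZagier.<Decl> := …` in Summits/BirchSwinnertonDyer/BirchSwinnertonDyer/Theorems/<Name>.lean.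
-/

namespace Summit.BirchSwinnertonDyer.BirchSwinnertonDyer.Theses.HigherGrossZagier

open scoped BigOperators Topology Manifold Classical MeasureTheory ProbabilityTheory Matrix InnerProductSpace ComplexConjugate ContinuousMap
open Filter Set Function TopologicalSpace MeasureTheory

attribute [summit_statement] _root_.BirchSwinnertonDyer

open Literature

/-- item stmt-BirchSwinnertonDyer-0499 · target · rank 0 · closed · moot by None · by planner
why it might fail: X = (rank-r_an datum for all E) AND UB. With c free, X <=> BSD-rank AND L^(r_an)(E,1)/r_an! > 0 (refuters pool-4/9): false iff some E/Q has r_MW != r_an, or some L(E,s) has a real zero in (1,3/2] (excluded only by GRH). Both open for r_an >= 2; r_an <= 1 known (GZ86+Kolyvagin; Guo1996 sign at r=0).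
sources: GrossZagier1986 Thm I.6.3 + V.2; Kolyvagin1990 Thm A; Guo1996 (L(E,1) >= 0); tree facts WeierstrassCurve.gross_zagier_rank_one_rat (GrossZagierRankOne.lean:46), rank_eq_analyticRank_of_analyticRank_le_one (LeadingTerm.lean:274), YunZhang2017 = arXiv:1512.02683 App. A p.74 ('positivity of the leading coefficient ... is implied by the Riemann hypothesis'); arXiv:2605.09251 (2026) Thm 1.1 (signs of Taylor coefficients of twists under GRH only), Venjakob in book:burns2007-l-functions-galois-representations p.393 Conj. 3.2 (order of vanishing, Deligne-Beilinson) and p.394 Conj. 3.5 + Ex. 3.4B (leading term = period x Neron-Tate regulator up to Q^x): X is the real-coefficient weakening of this shape plus the sign, refuter-refute-pool-4 / pool-9 notes on stmt-0499 (2026-08-13): free-c degeneracy, readback of leadingLCoeff / heightPairing / mordellWeilRank; assembly Literature.EllArith.higherGZ_assembly in tree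
SUPERSEDES stmt-BirchSwinnertonDyer-0258 (r2). The old item was FALSELY closed 2026-08-13T06:58:11Z
by the gate decides-probe of p2749 as 'proved' by
Literature.EllArith.HigherGrossZagierDatum.leadingLCoeff_eq / det_ne_zero_of_leadingLCoeff_ne_zero —
lemmas taking (D : HigherGrossZagierDatum W W.analyticRank) as hypothesis, which cannot inhabit this
Prop (the same probe 'proved' both old 0145 and its negation-side 0257). Statement, rank and route
unchanged; grounder/refuter notes on stmt-BirchSwinnertonDyer-0258 remain valid and should be
copied, not redone. Thesis X of route HigherGrossZagier. Posited interface (inlined): rank-r GZ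
datum = r points P_i ∈ E(ℚ) and c > 0 with leadingLCoeff = c · det of the Néron–Tate Gram matrix
(Clay normalisation of heightPairing). X = existence for r = analyticRank, plus UB rank ≤
analyticRank. GrossZagier1986 Thm I.6.3 (r = 1), YuanZhangZhang2013, GrossKohnenZagier1987,
DarmonRotger2017, Zhang2014. imports: Summits.BirchSwinnertonDyer.Statement,
Literature.NumberTheory.EllipticCurves.{Selmer,Sha,Heights,GaloisAction,Tamagawa,BSDInvariants}
(routes/Sketch.lean, lean check rc 0 on 2026-08-13). -/
@[route_item "route-BirchSwinnertonDyer-HigherGrossZagier"]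
def HigherGZThesisR2 : Prop :=
  (∀ (W : WeierstrassCurve ℚ) [W.IsElliptic], ∃ (P : Fin W.analyticRank → W.toAffine.Point) (c : ℝ), 0 < c ∧ W.leadingLCoeff = ((c * (Matrix.of fun i j => (P i).heightPairing (P j)).det : ℝ) : ℂ)) ∧ (∀ (W : WeierstrassCurve ℚ) [W.IsElliptic], W.mordellWeilRank ≤ W.analyticRank)

/-- item stmt-BirchSwinnertonDyer-23489 · crux · rank 2 · closed · moot by None · by planner
why it might fail: No construction of even one non-torsion point of E(Q) is known once L(E,1)=L'(E,1)=0: Heegner points torsion (Gross' trap), number-field Sht^r only for r<=1, plectic points/classes and generalised Kato classes conjectural or Selmer-level; one curve with r_an>=2>rank kills it.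
sources: arXiv:1512.02683 p.3 (YunZhang2017: no number-field Sht^r for r>=2), arXiv:1710.04956 §4 p.7 (Loeffler–Zerbes: Gross' trap; no rank-r Euler system related to L-values known), arXiv:2104.12575 p.3 (ForneaGehrmann2023: plectic Stark–Heegner points, conjectural), arXiv:2603.28327 Conj. 1.9/1.10 (Fornea 2026: plectic Heegner classes vs wedge^r A, conjectural), doi:10.1186/s40687-016-0074-9 p.4 (DarmonRotger2016: generalised Kato classes, Selmer level), Literature.Barriers.BirchSwinnertonDyer.HeegnerPointBarrier
[crux] (route-lead g0 node repair, 2026-08-30; piece WEAKER than the summit) Lower bound in analytic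
rank ≥ 2: for every elliptic E/ℚ with r_an(E) ≥ 2, r_an(E) ≤ rank E(ℚ). This is the load-bearing
half of the former route-own crux HigherGZConstructionR2 (stmt-BirchSwinnertonDyer-0501), which with
c free is EXACTLY HigherGZLowerBoundR2 ∧ SIGN2 where SIGN2 = `2 ≤ r_an → 0 < leadingLCoeff.re ∧
leadingLCoeff.im = 0` (positivity of L^{(r)}(E,1)/r!, beyond the rank-only summit, known only under
GRH) — kernel certificate `construction_iff` (planner Sketch.lean, lean check rc 0, axioms
propext/Classical.choice/Quot.sound; = refuter Collapse.lean `HigherGZReview.constructionR2_iff`,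
2026-08-15). BSD-rank ⇒ this item trivially (`lowerBound_of_bsd`); the converse probe
`HigherGZLowerBoundR2 → BirchSwinnertonDyer` FAILS (bc/ probe rc 1, #h21_crux_probe VERDICT CLEAN).
The deciding theorem is re-glued on (this, SqueezeUBR2, HigherGZRankOneR2). Cross-map (no
duplication): implies route Squeeze's SqueezeOnePoint (stmt-0143, `2 ≤ r_an → 1 ≤ rank`, its weakest
unknown consequence); implied by route SelmerRank's SelmerRankLB ∧ SelmerRankShaPFinite (stmt-0131 ∧
0132). WHY IT MIGHT FAIL: no construct -/
@[route_item "route-BirchSwinnertonDyer-HigherGrossZagier", crux]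
def HigherGZLowerBoundR2 : Prop :=
  ∀ (W : WeierstrassCurve ℚ) [W.IsElliptic], 2 ≤ W.analyticRank → W.analyticRank ≤ W.mordellWeilRank

/-- item stmt-BirchSwinnertonDyer-0496 · crux · rank 4 · open · by planner
why it might fail: 'No excess rank' r_MW <= r_an is OPEN for all r_an >= 2 (known r_an <= 1: GZ86+Kolyvagin, Kato 14.2); every unconditional UB on r_MW goes via corank Sel_p^inf <= ord_T L_p (Kato 18.4) and ord_T L_p <= ord_{s=1} L is open; one curve with r_MW > r_an kills it and BSD.
sources: Kolyvagin1990 Thm A, Kato2004 (Asterisque 295) Thm 14.2(2)/Cor 14.3, Thm 18.4, arXiv:1512.06894 p.3 (JetchevSkinnerWan2017), Literature.Barriers.BirchSwinnertonDyer.SelmerRankBarrier, Literature.Barriers.BirchSwinnertonDyer.PAdicHeightBarrier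
SUPERSEDES stmt-BirchSwinnertonDyer-0145 (r2). The old item was FALSELY closed 2026-08-13T06:58:11Z
by the gate decides-probe of p2749 as 'proved' by
Literature.EllArith.HigherGrossZagierDatum.leadingLCoeff_eq / det_ne_zero_of_leadingLCoeff_ne_zero —
lemmas taking (D : HigherGrossZagierDatum W W.analyticRank) as hypothesis, which cannot inhabit this
Prop (the same probe 'proved' both old 0145 and its negation-side 0257). Statement, rank and route
unchanged; grounder/refuter notes on stmt-BirchSwinnertonDyer-0145 remain valid and should be
copied, not redone. Upper bound: the Mordell–Weil rank never exceeds the analytic rank. Known when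
r_an ≤ 1 (Kolyvagin1990; Kato2004 Thm 14.2 for r_an = 0). Shared verbatim with HigherGrossZagier
(dedup). Its negation is Squeeze#6. imports: Summits.BirchSwinnertonDyer.Statement,
Literature.NumberTheory.EllipticCurves.{Selmer,Sha,Heights,GaloisAction,Tamagawa,BSDInvariants}
(routes/Sketch.lean, lean check rc 0 on 2026-08-13). -/
@[route_item "route-BirchSwinnertonDyer-HigherGrossZagier", crux]
def SqueezeUBR2 : Prop :=
  ∀ (W : WeierstrassCurve ℚ) [W.IsElliptic], W.mordellWeilRank ≤ W.analyticRank

/-- item stmt-BirchSwinnertonDyer-0258 · support · rank 0 · closed · moot by None · by planner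
Thesis X of route HigherGrossZagier. Posited interface (inlined): rank-r GZ datum = r points P_i ∈
E(ℚ) and c > 0 with leadingLCoeff = c · det of the Néron–Tate Gram matrix (Clay normalisation of
heightPairing). X = existence for r = analyticRank, plus UB rank ≤ analyticRank. GrossZagier1986 Thm
I.6.3 (r = 1), YuanZhangZhang2013, GrossKohnenZagier1987, DarmonRotger2017, Zhang2014. imports:
Summits.BirchSwinnertonDyer.Statement,
Literature.NumberTheory.EllipticCurves.{Selmer,Sha,Heights,GaloisAction,Tamagawa,BSDInvariants}
(routes/Sketch.lean, lean check rc 0 on 2026-08-13). -/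
@[route_item "route-BirchSwinnertonDyer-HigherGrossZagier"]
def HigherGZThesis : Prop :=
  (∀ (W : WeierstrassCurve ℚ) [W.IsElliptic], ∃ (P : Fin W.analyticRank → W.toAffine.Point) (c : ℝ), 0 < c ∧ W.leadingLCoeff = ((c * (Matrix.of fun i j => (P i).heightPairing (P j)).det : ℝ) : ℂ)) ∧ (∀ (W : WeierstrassCurve ℚ) [W.IsElliptic], W.mordellWeilRank ≤ W.analyticRank)

/-- item stmt-BirchSwinnertonDyer-0147 · support · rank 2 · closed · moot by None · by planner
The construction item of the posited object: for r_an ≥ 2 produce r_an rational points whose height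
regulator is a positive multiple of L^{(r)}(E,1)/r!. No candidate construction is known over ℚ;
programmes: arithmetic diagonal cycles (DarmonRotger2017), Kudla arithmetic theta series, higher
Heegner/CM cycles (YuanZhangZhang2013, Zhang2014), plectic Heegner points. Implies Squeeze#2 and #3.
BSD leading-term formula predicts c = Ω_E ∏c_p #Ш /(#tors² · index²). imports:
Summits.BirchSwinnertonDyer.Statement,
Literature.NumberTheory.EllipticCurves.{Selmer,Sha,Heights,GaloisAction,Tamagawa,BSDInvariants}
(routes/Sketch.lean, lean check rc 0 on 2026-08-13). -/
@[route_item "route-BirchSwinnertonDyer-HigherGrossZagier"]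
def HigherGZConstruction : Prop :=
  ∀ (W : WeierstrassCurve ℚ) [W.IsElliptic], 2 ≤ W.analyticRank → ∃ (P : Fin W.analyticRank → W.toAffine.Point) (c : ℝ), 0 < c ∧ W.leadingLCoeff = ((c * (Matrix.of fun i j => (P i).heightPairing (P j)).det : ℝ) : ℂ)

/-- item stmt-BirchSwinnertonDyer-0501 · aside · rank 2 · closed · moot by None · by planner
why it might fail: Forces r_an <= r_MW for every r_an >= 2 (no construction of even ONE non-torsion point is known once L(E,1)=L'(E,1)=0: Heegner points are torsion, HeegnerPointBarrier; number-field Sht^r exists only for r<=1) AND L^(r)(E,1)/r! > 0 (r>=2: known only under GRH). c free => no cycle formula is pinned.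
sources: YunZhang2017 = arXiv:1512.02683, p.3 (number-field analogue of Sht^r_G 'only exist ... when r <= 1'; no precise conjecture formulated) and App. A p.74 (positivity of the leading coefficient <= GRH), p.76 Rem. 102 (first derivative: known via GZ), GrossZagier1986, Thm I.6.3 + sec. V.2 (r = 1 model of the datum); YuanZhangZhang2013 Thm 1.2 (still a first-derivative formula), ForneaGehrmann2023 = arXiv:2104.12575, p.3 ('long-standing open problem ... modular construction of P in wedge^r A(E) non-torsion exactly when r_alg = r'; plectic, conjectural, p-adic), DarmonRotger2016 = doi:10.1186/s40687-016-0074-9, p.4 ('p-adic Gross-Zagier formula in analytic rank two' = two generalised Kato CLASSES, Selmer level); CastellaHsieh2022 = arXiv:1809.09066 (rank 2, derived p-adic heights), Literature.Barriers.BirchSwinnertonDyer.HeegnerPointBarrier (Literature/Barriers/BirchSwinnertonDyer/HeegnerPointsRankOne.lean:87); Literature.Barriers.BirchSwinnertonDyer.SelmerRankBarrier (SelmerVersusMordellWeil.lean:84: classes are not points while Sha[p^inf] is unbounded), refuter-refute-pool-4/7/9 notes on stmt-0501 (2026-08-13): with c free the item <=> (2 <= r_an -> r_an <= rank AND 0 <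 L^(r_an)(E,1)/r_an! in R); no cheap counterexample (LMFDB leading terms positive, r_an <= 3)
SUPERSEDES stmt-BirchSwinnertonDyer-0147 (r2). The old item was FALSELY closed 2026-08-13T06:58:11Z
by the gate decides-probe of p2749 as 'proved' by
Literature.EllArith.HigherGrossZagierDatum.leadingLCoeff_eq / det_ne_zero_of_leadingLCoeff_ne_zero —
lemmas taking (D : HigherGrossZagierDatum W W.analyticRank) as hypothesis, which cannot inhabit this
Prop (the same probe 'proved' both old 0145 and its negation-side 0257). Statement, rank and route
unchanged; grounder/refuter notes on stmt-BirchSwinnertonDyer-0147 remain valid and should be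
copied, not redone. The construction item of the posited object: for r_an ≥ 2 produce r_an rational
points whose height regulator is a positive multiple of L^{(r)}(E,1)/r!. No candidate construction
is known over ℚ; programmes: arithmetic diagonal cycles (DarmonRotger2017), Kudla arithmetic theta
series, higher Heegner/CM cycles (YuanZhangZhang2013, Zhang2014), plectic Heegner points. Implies
Squeeze#2 and #3. BSD leading-term formula predicts c = Ω_E ∏c_p #Ш /(#tors² · index²). imports:
Summits.BirchSwinnertonDyer.Statement,
Literature.NumberTheory.EllipticCurves.{Selmer,Sha,Heights,GaloisAction,Tamagawa,BSDInvariants}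
(routes/Sketch.lean, lean c -/
@[route_item "route-BirchSwinnertonDyer-HigherGrossZagier"]
def HigherGZConstructionR2 : Prop :=
  ∀ (W : WeierstrassCurve ℚ) [W.IsElliptic], 2 ≤ W.analyticRank → ∃ (P : Fin W.analyticRank → W.toAffine.Point) (c : ℝ), 0 < c ∧ W.leadingLCoeff = ((c * (Matrix.of fun i j => (P i).heightPairing (P j)).det : ℝ) : ℂ)

/-- item stmt-BirchSwinnertonDyer-0148 · support · rank 3 · closed · moot by None · by planner
Rank-one instance of the interface over ℚ, Literature-reachable: choose imaginary quadratic K with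
Heegner hypothesis and L(E^{d_K},1) ≠ 0 (BumpFriedbergHoffstein1990 / MurtyMurty1991; sign forces
r_an(E^{d_K}) even), apply GrossZagier1986 Thm I.6.3 (=
Literature.NumberTheory.EllipticCurves.gross_zagier, constant
Literature.NumberTheory.EllipticCurves.grossZagierConstant_pos) to get L'(E,1)·L(E^D,1) = c_K
ĥ_K(P_K), take P = Tr_{K/ℚ} P_K (up to 2-power index) and divide by L(E^D,1) > 0 (GrossZagier1986
V.§2; Gross1991 §2; Kolyvagin1990). Validates normalisations of leadingLCoeff and canonicalHeight
(Clay, no ½). imports: Summits.BirchSwinnertonDyer.Statement,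
Literature.NumberTheory.EllipticCurves.{Selmer,Sha,Heights,GaloisAction,Tamagawa,BSDInvariants}
(routes/Sketch.lean, lean check rc 0 on 2026-08-13). -/
@[route_item "route-BirchSwinnertonDyer-HigherGrossZagier"]
def HigherGZRankOne : Prop :=
  ∀ (W : WeierstrassCurve ℚ) [W.IsElliptic], W.analyticRank = 1 → ∃ (P : W.toAffine.Point) (c : ℝ), 0 < c ∧ W.leadingLCoeff = ((c * P.canonicalHeight : ℝ) : ℂ)

/-- item stmt-BirchSwinnertonDyer-0502 · support · rank 3 · closed · moot by None · by planner
SUPERSEDES stmt-BirchSwinnertonDyer-0148 (r2). The old item was FALSELY closed 2026-08-13T06:58:11Z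
by the gate decides-probe of p2749 as 'proved' by
Literature.EllArith.HigherGrossZagierDatum.leadingLCoeff_eq / det_ne_zero_of_leadingLCoeff_ne_zero —
lemmas taking (D : HigherGrossZagierDatum W W.analyticRank) as hypothesis, which cannot inhabit this
Prop (the same probe 'proved' both old 0145 and its negation-side 0257). Statement, rank and route
unchanged; grounder/refuter notes on stmt-BirchSwinnertonDyer-0148 remain valid and should be
copied, not redone. Rank-one instance of the interface over ℚ, Literature-reachable: choose
imaginary quadratic K with Heegner hypothesis and L(E^{d_K},1) ≠ 0 (BumpFriedbergHoffstein1990 /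
MurtyMurty1991; sign forces r_an(E^{d_K}) even), apply GrossZagier1986 Thm I.6.3 (=
Literature.NumberTheory.EllipticCurves.gross_zagier, constant
Literature.NumberTheory.EllipticCurves.grossZagierConstant_pos) to get L'(E,1)·L(E^D,1) = c_K
ĥ_K(P_K), take P = Tr_{K/ℚ} P_K (up to 2-power index) and divide by L(E^D,1) > 0 (GrossZagier1986
V.§2; Gross1991 §2; Kolyvagin1990). Validates normalisations of leadingLCoeff and canonicalHeight
(Clay, no ½). imports: Summits -/
@[route_item "route-BirchSwinnertonDyer-HigherGrossZagier", crux]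
def HigherGZRankOneR2 : Prop :=
  ∀ (W : WeierstrassCurve ℚ) [W.IsElliptic], W.analyticRank = 1 → ∃ (P : W.toAffine.Point) (c : ℝ), 0 < c ∧ W.leadingLCoeff = ((c * P.canonicalHeight : ℝ) : ℂ)

/-- item stmt-BirchSwinnertonDyer-0145 · support · rank 4 · open · by planner
Upper bound: the Mordell–Weil rank never exceeds the analytic rank. Known when r_an ≤ 1
(Kolyvagin1990; Kato2004 Thm 14.2 for r_an = 0). Shared verbatim with HigherGrossZagier (dedup). Its
negation is Squeeze#6. imports: Summits.BirchSwinnertonDyer.Statement,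
Literature.NumberTheory.EllipticCurves.{Selmer,Sha,Heights,GaloisAction,Tamagawa,BSDInvariants}
(routes/Sketch.lean, lean check rc 0 on 2026-08-13). -/
@[route_item "route-BirchSwinnertonDyer-HigherGrossZagier"]
def SqueezeUB : Prop :=
  ∀ (W : WeierstrassCurve ℚ) [W.IsElliptic], W.mordellWeilRank ≤ W.analyticRank

/-- item stmt-BirchSwinnertonDyer-0149 · support · rank 5 · closed · moot by None · by planner
Linear algebra + heights: the Néron–Tate pairing is bilinear, symmetric and kills torsion (facts
WeierstrassCurve.Affine.Point.heightPairing_add_left, heightPairing_self,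
canonicalHeight_of_isOfFinAddOrder, parallelogram_law in Heights.lean), so it factors through
E(ℚ)/tors ⊗ ℝ; a ℤ-relation among the P_i mod torsion gives a kernel vector of the Gram matrix;
hence the images are ℤ-independent in the free module E(ℚ)/tors of finrank = mordellWeilRank
(module_finite_point, Mordell–Weil). Silverman AEC VIII.9.3, Cremona1997 §3.4. Provable now (takes
the Heights facts as hypotheses if still named facts). imports:
Summits.BirchSwinnertonDyer.Statement,
Literature.NumberTheory.EllipticCurves.{Selmer,Sha,Heights,GaloisAction,Tamagawa,BSDInvariants}
(routes/Sketch.lean, lean check rc 0 on 2026-08-13). -/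
@[route_item "route-BirchSwinnertonDyer-HigherGrossZagier"]
def HigherGZGramLemma : Prop :=
  (∀ (V : WeierstrassCurve ℚ) [V.IsElliptic], @WeierstrassCurve.Affine.Point.heightPairing_add_left ℚ _ _ V) → ∀ (W : WeierstrassCurve ℚ) [W.IsElliptic], W.module_finite_point → ∀ (n : ℕ) (P : Fin n → W.toAffine.Point), (Matrix.of fun i j => (P i).heightPairing (P j)).det ≠ 0 → n ≤ W.mordellWeilRank

/-- item stmt-BirchSwinnertonDyer-0503 · support · rank 5 · closed · moot by None · by planner
SUPERSEDES stmt-BirchSwinnertonDyer-0149 (r2). The old item was FALSELY closed 2026-08-13T06:58:11Z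
by the gate decides-probe of p2749 as 'proved' by
Literature.EllArith.HigherGrossZagierDatum.leadingLCoeff_eq / det_ne_zero_of_leadingLCoeff_ne_zero —
lemmas taking (D : HigherGrossZagierDatum W W.analyticRank) as hypothesis, which cannot inhabit this
Prop (the same probe 'proved' both old 0145 and its negation-side 0257). Statement, rank and route
unchanged; grounder/refuter notes on stmt-BirchSwinnertonDyer-0149 remain valid and should be
copied, not redone. Linear algebra + heights: the Néron–Tate pairing is bilinear, symmetric and
kills torsion (facts WeierstrassCurve.Affine.Point.heightPairing_add_left, heightPairing_self,
canonicalHeight_of_isOfFinAddOrder, parallelogram_law in Heights.lean), so it factors through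
E(ℚ)/tors ⊗ ℝ; a ℤ-relation among the P_i mod torsion gives a kernel vector of the Gram matrix;
hence the images are ℤ-independent in the free module E(ℚ)/tors of finrank = mordellWeilRank
(module_finite_point, Mordell–Weil). Silverman AEC VIII.9.3, Cremona1997 §3.4. Provable now (takes
the Heights facts as hypotheses if still named facts). imports: Summits.BirchSwinn -/
@[route_item "route-BirchSwinnertonDyer-HigherGrossZagier"]
def HigherGZGramLemmaR2 : Prop :=
  (∀ (V : WeierstrassCurve ℚ) [V.IsElliptic], @WeierstrassCurve.Affine.Point.heightPairing_add_left ℚ _ _ V) → ∀ (W : WeierstrassCurve ℚ) [W.IsElliptic], W.module_finite_point → ∀ (n : ℕ) (P : Fin n → W.toAffine.Point), (Matrix.of fun i j => (P i).heightPairing (P j)).det ≠ 0 → n ≤ W.mordellWeilRank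

/-- item stmt-BirchSwinnertonDyer-0524 · support · rank 6 · closed · moot by None · by planner
r5 (session 67): RANK-ONE INSTANCE OF THE POSITED INTERFACE, conditional on two Literature named
facts. Reaction to crux #3 (stmt-BirchSwinnertonDyer-0502, 'r_an = 1 → ∃ P, c > 0, leadingLCoeff =
c·ĥ(P)') having become VERBATIM the named fact WeierstrassCurve.gross_zagier_rank_one_rat
(Literature/NumberTheory/EllipticCurves/GrossZagierRankOne.lean:46, in tree; grounder verdict on
0148/0502 = KNOWN: GrossZagier1986 Thm I.6.3 + §V.2, twist non-vanishing BumpFriedbergHoffstein1990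
/ MurtyMurty1991 = fact wi-03673 DONE). Per D-0014 the route now takes (h :
gross_zagier_rank_one_rat) as hypothesis; discharging 0502 itself = `theorem
gross_zagier_rank_one_rat_holds` is Literature-side work (descent K → ℚ from
Literature.NumberTheory.EllipticCurves.gross_zagier, HeegnerPoints.lean:369) and is no longer ranked
as a route crux (#3 slot = 'fact'). STATEMENT: assuming (h₁) rank-one Gross–Zagier over ℚ and (h₂)
⟨P,P⟩_NT = ĥ(P) (WeierstrassCurve.Affine.Point.heightPairing_self, Heights.lean:223, Silverman AEC
VIII.9.3 — a named fact because canonicalHeight_nsmul is), every E/ℚ with r_an(E) = 1 carries a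
HigherGrossZagierDatum at r = r_an (Summits/BirchSwinnertonDyer/BirchSwinnertonDyer/Theorems -/
@[route_item "route-BirchSwinnertonDyer-HigherGrossZagier"]
def HigherGZRankOneDatumR5 : Prop :=
  HigherGZRankOneR2 → (∀ (V : WeierstrassCurve ℚ), @WeierstrassCurve.Affine.Point.heightPairing_self ℚ _ _ V) → ∀ (W : WeierstrassCurve ℚ) [W.IsElliptic], W.analyticRank = 1 → Nonempty (Literature.EllArith.HigherGrossZagierDatum W W.analyticRank)

/-- item stmt-BirchSwinnertonDyer-14178 · support · rank 7 · closed · moot by None · by planner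
[support] RANK-ZERO LEAF of the target glue (route-choice repair 2026-08-16, option (a) of the
operator hold route.target-unreachable: makes the target HigherGZThesisR2 reachable from the items
via HigherGZTargetGlueR2). STATEMENT: if r_an(E) = 0 then leadingLCoeff E (= L(E,1), the 0-th Taylor
coefficient) is a positive real — the r = 0 instance of the posited rank-r datum (empty family of
points, det of the 0×0 Gram matrix = 1), i.e. exactly the part of X = HigherGZThesisR2 at r_an = 0
that neither crux nor HigherGZRankOneR2 speaks to (refuter Collapse.lean: X ↔ BSD-rank ∧ ∀ E,
leadingLCoeff ∈ ℝ_{>0}). KNOWN modulo the same tier-0 Literature debt as HigherGZRankOneR2: (i)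
modularity ⇒ entire continuation (BCDTJAMS2001 Thm A; tree fact
WeierstrassCurve.hasEntireLFunction_rat, AnalyticRank.lean), hence r_an = 0 ⇔ L(E,1) ≠ 0
(WeierstrassCurve.analyticRank_eq_zero_iff_holds, AnalyticRankOrderProofs.lean:72, PROVED); (ii)
L(E,1) ∈ ℝ (integer Dirichlet coefficients + reflection principle, SilvermanAEC2009 C.16; tree fact
WeierstrassCurve.leadingLCoeff_im_eq_zero, BSDInvariants.lean:391); (iii) L(E,1) ≥ 0 (Guo1996 = Duke
Math. J. 83 (1996) 157–190; LapidRallis2003 Thm 1, case n = 2; tree -/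
@[route_item "route-BirchSwinnertonDyer-HigherGrossZagier"]
def HigherGZRankZeroR2 : Prop :=
  ∀ (W : WeierstrassCurve ℚ) [W.IsElliptic], W.analyticRank = 0 → ∃ c : ℝ, 0 < c ∧ W.leadingLCoeff = (c : ℂ)

/-- item stmt-BirchSwinnertonDyer-14219 · support · rank 8 · closed · moot by None · by planner
[support] TARGET GLUE (route-choice repair 2026-08-16, option (a) of the operator hold
route.target-unreachable 'no item concludes the target HigherGZThesisR2'): the target X =
HigherGZThesisR2 from the route's items — HigherGZRankZeroR2 (r_an = 0 leaf: L(E,1) ∈ ℝ_{>0}) →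
HigherGZRankOneR2 (r_an = 1 leaf: rank-one Gross–Zagier over ℚ) → HigherGZConstructionR2 (crux #2:
the datum for r_an ≥ 2) → SqueezeUBR2 (crux #4: no excess rank = the second conjunct of X verbatim)
→ HigherGZThesisR2. PROVABLE NOW — pure logic over in-tree discharged facts; planner Sketch.lean
`targetGlue_holds : HigherGZTargetGlueR2` is sorry-free with axioms propext / Classical.choice /
Quot.sound (lean check rc 0, 2026-08-16; attached as evidence): case r_an = 0 — P := the constant
family on Fin r_an (empty), det of the 0×0 Gram matrix = 1 (generalise n = W.analyticRank, subst,
Matrix.det_fin_zero), c from HigherGZRankZeroR2; case r_an = 1 — P := the constant family at the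
Gross–Zagier point Q of HigherGZRankOneR2, every Gram entry is ⟨Q,Q⟩ = ĥ(Q) by
WeierstrassCurve.Affine.Point.heightPairing_self_holds (HeightsProofs.lean:587), det of the 1×1
matrix = ĥ(Q) (subst, Matrix.det_fin_one); case r_an ≥ 2 — HigherG -/
@[route_item "route-BirchSwinnertonDyer-HigherGrossZagier"]
def HigherGZTargetGlueR2 : Prop :=
  HigherGZRankZeroR2 → HigherGZRankOneR2 → HigherGZConstructionR2 → SqueezeUBR2 → HigherGZThesisR2

/-- item stmt-BirchSwinnertonDyer-1034 · assembly · rank 1 · closed · moot by None · by planner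
[assembly] r6 (route-repair 2026-08-15) — MODULARITY-FREE ASSEMBLY, the cruxes straight to the
statement: HigherGZConstructionR2 (rank-r_an Gross–Zagier datum for r_an ≥ 2) → SqueezeUBR2 (no
excess rank) → HigherGZRankOneR2 (r_an = 1: Gross–Zagier over ℚ, verbatim the named fact
WeierstrassCurve.gross_zagier_rank_one_rat, D-0014 hypothesis leaf) → BirchSwinnertonDyer.
SUPERSEDES IN SUBSTANCE Assembly2 (stmt-BirchSwinnertonDyer-0500) and Assembly (0259), which take (∀
W, W.leadingLCoeff_ne_zero) and WeierstrassCurve.hasEntireLFunction_rat (modularity ⇒ entire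
continuation; XL, unproved in tree — the one unproved fact of the route's import cone) as
hypotheses; those two stay only because this repair unit lacks tenure rights to drop/restate (tenure
planner: drop them, see route note). WHY THE HYPOTHESES ARE UNNECESSARY: the junk-robust dichotomy
`∀ W, W.analyticRank = 0 ∨ W.leadingLCoeff ≠ 0` is pure Mathlib
(analyticOrderNatAt_of_not_analyticAt, ENat.coe_toNat,
natCast_le_analyticOrderAt_iff_iteratedDeriv_eq_zero; same argument as leadingLCoeff_ne_zero_holds,
AnalyticRankOrderProofs.lean:85, minus HasEntireLFunction): if analyticRank ≠ 0 then entireLFunction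
is analytic at 1, not eve -/
@[route_item "route-BirchSwinnertonDyer-HigherGrossZagier"]
def Assembly3 : Prop :=
  HigherGZConstructionR2 → SqueezeUBR2 → HigherGZRankOneR2 → BirchSwinnertonDyer

-- records of items no longer active in this route (dropped / restated):
-- earlier Assembly (stmt-BirchSwinnertonDyer-0259, dropped 2026-08-16T14:43:05Z): moot by None — (∀ (W : WeierstrassCurve ℚ) [W.IsElliptic], W.HasEntireLFunction → W.leadingLCoeff ≠ 0) → (∀ (W : WeierstrassCurve ℚ) [W.IsElliptic], W.HasEntireLFunction) → (∀ (W : WeierstrassCurve ℚ) [W.IsElliptic] (n : ℕ) (P : Fin n → W.toAffine.Point), (Matrix.of fun i j => (P i).heightPairing (P j)).det ≠ 0 → n ≤ W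
-- earlier Assembly2 (stmt-BirchSwinnertonDyer-0500, dropped 2026-08-16T14:43:05Z): moot by None — (∀ (W : WeierstrassCurve ℚ) [W.IsElliptic], W.HasEntireLFunction → W.leadingLCoeff ≠ 0) → (∀ (W : WeierstrassCurve ℚ) [W.IsElliptic], W.HasEntireLFunction) → (∀ (W : WeierstrassCurve ℚ) [W.IsElliptic] (n : ℕ) (P : Fin n → W.toAffine.Point), (Matrix.of fun i j => (P i).heightPairing (P j)).det ≠ 0 → n ≤ 

/-! D-0027 §2.1 — DECIDING THEOREM (planner-authored via `route open/edit --closes-file`; by planner-rlead-bsd-HigherGrossZagier-g0-0 2026-08-30T00:40:09Z) — ARCHIVED: route closed (superseded) 2026-08-30T01:20:29Z; kept so importers keep building: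
its hypotheses are this route's items and its conclusion the sub-problem Statement (glue_lint), and it elaborates with this file. -/

/-- DECIDING THEOREM (D-0027 §2.1) of route HigherGrossZagier (route-lead g0 node repair,
2026-08-30). The former route-own crux `HigherGZConstructionR2` (stmt-0501) is, with `c` free,
exactly `HigherGZLowerBoundR2 ∧ HigherGZSignR2` (kernel certificate `construction_iff`, planner
Sketch.lean rc 0; refuter Collapse.lean `constructionR2_iff`, 2026-08-15); only the lower-bound half
is needed for the rank-only summit, so `closes` is re-glued on the WEAKER crux
`HigherGZLowerBoundR2` (`2 ≤ r_an → r_an ≤ rank`), the shared crux `SqueezeUBR2` (no excess rank)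
and the literature leaf `HigherGZRankOneR2` (verbatim the named fact
`WeierstrassCurve.gross_zagier_rank_one_rat`, Gross–Zagier 1986 Thm. I.6.3 + §V.2).
NO modularity / `hasEntireLFunction_rat` hypothesis: if `r_an(W) ≠ 0` then `W.entireLFunction` is
analytic at `1` of finite order `r_an` (junk-robust reading of `analyticOrderNatAt`), so
`leadingLCoeff W ≠ 0` by pure Mathlib; the rank-one point is fed to the tree's
`Literature.EllArith.gram_lemma` (Theorems/HigherGrossZagierGram.lean) with the discharged facts
`WeierstrassCurve.module_finite_point_holds` (Mordell–Weil) and `heightPairing_add_left_holds`;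
`⟨P,P⟩ = ĥ P` is `heightPairing_self_holds` (HeightsProofs.lean).
Axioms: propext, Classical.choice, Quot.sound. -/
@[closes "route-BirchSwinnertonDyer-HigherGrossZagier"] theorem closes (hLB : HigherGZLowerBoundR2) (hUB : SqueezeUBR2) (hR1 : HigherGZRankOneR2) :
    _root_.BirchSwinnertonDyer := by
  unfold _root_.BirchSwinnertonDyer Literature.BSDRankConjecture
  intro W hE
  haveI : W.IsElliptic := hE
  -- (1) junk-robust non-vanishing of the leading Taylor coefficient (no `HasEntireLFunction`)
  have hlead : W.analyticRank ≠ 0 → W.leadingLCoeff ≠ 0 := by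
    intro hr
    have hr' : analyticOrderNatAt W.entireLFunction 1 ≠ 0 := hr
    have han : AnalyticAt ℂ W.entireLFunction 1 := by
      by_contra hna
      exact hr' (analyticOrderNatAt_of_not_analyticAt hna)
    have htop : analyticOrderAt W.entireLFunction 1 ≠ ⊤ := by
      intro ht
      apply hr'
      rw [analyticOrderNatAt, ht, ENat.toNat_top]
    have hrk : ((W.analyticRank : ℕ) : ℕ∞) = analyticOrderAt W.entireLFunction 1 :=
      Nat.cast_analyticOrderNatAt htop
    have hderiv : iteratedDeriv W.analyticRank W.entireLFunction 1 ≠ 0 := by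
      intro h0
      have hle : ((W.analyticRank + 1 : ℕ) : ℕ∞) ≤ analyticOrderAt W.entireLFunction 1 := by
        rw [natCast_le_analyticOrderAt_iff_iteratedDeriv_eq_zero han]
        intro i hi
        rcases Nat.lt_succ_iff_lt_or_eq.mp hi with hi | rfl
        · exact (natCast_le_analyticOrderAt_iff_iteratedDeriv_eq_zero han).mp hrk.le i hi
        · exact h0
      rw [← hrk] at hle
      exact absurd (by exact_mod_cast hle : W.analyticRank + 1 ≤ W.analyticRank) (by omega)
    unfold WeierstrassCurve.leadingLCoeff
    exact div_ne_zero hderiv (by exact_mod_cast (Nat.factorial_pos _).ne')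
  -- (2) the Gram lemma, fed with the discharged Mordell–Weil and bilinearity facts
  have hgram := Literature.EllArith.gram_lemma W W.module_finite_point_holds
    WeierstrassCurve.Affine.Point.heightPairing_add_left_holds
  -- (3) lower bound `r_an ≤ rank`, by cases on `r_an`: 0 trivial, 1 Gross–Zagier, ≥ 2 the crux
  have hLB' : W.analyticRank ≤ W.mordellWeilRank := by
    rcases (show W.analyticRank = 0 ∨ W.analyticRank = 1 ∨ 2 ≤ W.analyticRank by omega) with
      h0 | h1 | h2
    · rw [h0]
      exact Nat.zero_le _
    · obtain ⟨P, c, hc, hL⟩ := hR1 W h1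
      have hne : W.leadingLCoeff ≠ 0 := hlead (by omega)
      have hh : P.canonicalHeight ≠ 0 := by
        intro hP
        apply hne
        rw [hL, hP, mul_zero, Complex.ofReal_zero]
      have hdet : (Matrix.of fun i j =>
          ((![P] : Fin 1 → W.toAffine.Point) i).heightPairing ((![P] : Fin 1 → W.toAffine.Point) j)).det ≠ 0 := by
        rw [Matrix.det_fin_one, Matrix.of_apply, Matrix.cons_val_fin_one,
          WeierstrassCurve.Affine.Point.heightPairing_self_holds P]
        exact hh
      have h1le : 1 ≤ W.mordellWeilRank := hgram 1 ![P] hdet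
      omega
    · exact hLB W h2
  exact le_antisymm hLB' (hUB W)

end Summit.BirchSwinnertonDyer.BirchSwinnertonDyer.Theses.HigherGrossZagier
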